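import Summits.QuantumFields.BalabanUV.T4Continuum.Support.NE7K1LinSchurLineDerivRel

/-!
# NE7K1LinInvAntitone — row NE7 (node U5), candidate route HOM, path H1L, cell K1-lin(s): THE INVERSE IS FORM-ANTITONE on real
# symmetric coercive matrices — a self-contained variational kit (no Löwner-order library): `P ⪯ κQ ⇒ Q⁻¹ ⪯ κP⁻¹`,
# `P ⪰ σ ⇒ P⁻¹ ⪯ σ⁻¹`, and «form bound ⇒ norm bound» for symmetric PSD matrices

Lineage `b2b-balaban-t4-ne7-p2` (CRUX PROVER NE7 #2), generation 65; the abstract half of `NE7K1LinTwoRunMonotone` (the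
LÖWNER-MONOTONE two-cutoff line at `A = 0`: `G(s) = (twoCutoffLine s)⁻¹` antitone in `s`, the integrated letter), split off so that
the line file stays one topic.  Over `NE7K1LinSchurLineDerivRel` (`dot_mulVec_comm_of_isSymm`, `abs_dot_mulVec_le_of_psd`,
`dot_le_of_coercive_pair`) and `NE7K1LinSchurLineForm.isUnit_det_of_coercive`.  All [folklore], for a finite index type `ι` and real
matrices, «`P ⪯ Q`» meaning `⟨w,Pw⟩ ≤ ⟨w,Qw⟩` for all `w`:

* `inv_form_ge_var`: the variational lower bound `2⟨g,w⟩ − ⟨w,Pw⟩ ≤ ⟨g,P⁻¹g⟩` (symmetric PSD invertible `P`; expand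
  `0 ≤ ⟨w − P⁻¹g, P(w − P⁻¹g)⟩`).
* **`inv_form_antitone_smul`**: `P` symmetric `σ`-coercive (`σ > 0`), `P ⪯ κQ` (`κ > 0`) ⇒ `Q⁻¹ ⪯ κP⁻¹` (the variational bound at
  `w = κ⁻¹Q⁻¹g`); `inv_form_antitone` = the case `κ = 1`.
* `inv_form_le_of_coercive`: `P ⪰ σ > 0` ⇒ `0 ≤ ⟨g,P⁻¹g⟩ ≤ ‖g‖²∕σ`.
* `mulVec_sq_le_of_psd`: a symmetric PSD `M` with `⟨w,Mw⟩ ≤ c‖w‖²` for all `w` (`c ≥ 0`) has `‖Mg‖² ≤ c²‖g‖²` (polarised AM–GM at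
  `λ = c⁻¹`, `z = Mg`).

HONEST FRAMING: linear algebra of finite real matrices, [folklore]; nothing of Bałaban's asserted; no `sorry`.  FIXED FINITE T⁴,
rung (B)+1; NE7 NOT PRINTED ∕ NOT PROVED; spine 0∕9; NOT infinite volume, NOT mass gap, NOT Clay.  HONEST DEPENDENCY: continuum YM on
T⁴ ⇐ BetaPertH ∧ nine spine estimates (0/9 proved); BetaPertH ⇐ (D1) ∧ (D4) ∧ CAP+tail; G-an2-4 gates asym, D1 and NE2/3/4.
-/

noncomputable section

open Finset Matrix

namespace Summit.QuantumFields.BalabanUV.T4Continuum.NE7K1LinInvAntitone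

open NE7K1LinSchurLineForm NE7K1LinSchurLineDerivRel

/-! ### The inverse is form-antitone on symmetric coercive matrices -/

section Abstract

variable {ι : Type*} [Fintype ι] [DecidableEq ι]

/-- **THE VARIATIONAL LOWER BOUND FOR THE INVERSE FORM**: for symmetric PSD invertible `P` and all `g, w`,
`2⟨g,w⟩ − ⟨w,Pw⟩ ≤ ⟨g,P⁻¹g⟩` (expand `0 ≤ ⟨w − P⁻¹g, P(w − P⁻¹g)⟩`). [folklore] -/
theorem inv_form_ge_var (P : Matrix ι ι ℝ) (hP : P.IsSymm) (hpsd : ∀ w, 0 ≤ w ⬝ᵥ P.mulVec w) (hPu : IsUnit P.det)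
    (g w : ι → ℝ) : 2 * (g ⬝ᵥ w) - w ⬝ᵥ P.mulVec w ≤ g ⬝ᵥ P⁻¹.mulVec g := by
  set u := P⁻¹.mulVec g with hu
  have hPu' : P.mulVec u = g := by rw [hu, mulVec_mulVec, mul_nonsing_inv _ hPu, one_mulVec]
  have e1 : w ⬝ᵥ P.mulVec u = g ⬝ᵥ w := by rw [hPu', dotProduct_comm]
  have e2 : u ⬝ᵥ P.mulVec w = g ⬝ᵥ w := by rw [dot_mulVec_comm_of_isSymm P hP u w, e1]
  have e3 : u ⬝ᵥ P.mulVec u = g ⬝ᵥ u := by rw [hPu', dotProduct_comm]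
  have h0 := hpsd (w - u)
  rw [mulVec_sub, sub_dotProduct, dotProduct_sub, dotProduct_sub, e1, e2, e3] at h0
  linarith

/-- **THE INVERSE IS FORM-ANTITONE, WITH A SCALAR**: `P, Q` symmetric, `P` `σ`-coercive (`σ > 0`), `⟨w,Pw⟩ ≤ κ⟨w,Qw⟩` for all `w`
(`κ > 0`) ⇒ `⟨g,Q⁻¹g⟩ ≤ κ⟨g,P⁻¹g⟩` (variational bound at `w = κ⁻¹Q⁻¹g`). [folklore] -/
theorem inv_form_antitone_smul (P Q : Matrix ι ι ℝ) (hP : P.IsSymm) {σ κ : ℝ} (hσ : 0 < σ) (hκ : 0 < κ)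
    (hPc : ∀ w, σ * (w ⬝ᵥ w) ≤ w ⬝ᵥ P.mulVec w) (hPQ : ∀ w, w ⬝ᵥ P.mulVec w ≤ κ * (w ⬝ᵥ Q.mulVec w)) (g : ι → ℝ) :
    g ⬝ᵥ Q⁻¹.mulVec g ≤ κ * (g ⬝ᵥ P⁻¹.mulVec g) := by
  have hQc : ∀ w, σ / κ * (w ⬝ᵥ w) ≤ w ⬝ᵥ Q.mulVec w := by
    intro w
    have h1 := (hPc w).trans (hPQ w)
    rw [div_mul_eq_mul_div, div_le_iff₀ hκ]
    linarith
  have hPu : IsUnit P.det := isUnit_det_of_coercive P hσ hPc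
  have hQu : IsUnit Q.det := isUnit_det_of_coercive Q (div_pos hσ hκ) hQc
  have hpsd : ∀ w, 0 ≤ w ⬝ᵥ P.mulVec w := fun w => le_trans (mul_nonneg hσ.le ((Finset.sum_nonneg fun i _ => mul_self_nonneg (w i)))) (hPc w)
  set u := Q⁻¹.mulVec g with hu
  have hQu' : Q.mulVec u = g := by rw [hu, mulVec_mulVec, mul_nonsing_inv _ hQu, one_mulVec]
  have e1 : g ⬝ᵥ u = u ⬝ᵥ Q.mulVec u := by rw [hQu', dotProduct_comm]
  have h := inv_form_ge_var P hP hpsd hPu g (κ⁻¹ • u)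
  rw [dotProduct_smul, mulVec_smul, smul_dotProduct, dotProduct_smul, smul_eq_mul, smul_eq_mul, smul_eq_mul, e1] at h
  have h2 := hPQ u
  -- `h : 2κ⁻¹⟨u,Qu⟩ − κ⁻²⟨u,Pu⟩ ≤ ⟨g,P⁻¹g⟩`, `h2 : ⟨u,Pu⟩ ≤ κ⟨u,Qu⟩`
  have h3 : κ⁻¹ * (κ⁻¹ * (u ⬝ᵥ P.mulVec u)) ≤ κ⁻¹ * (u ⬝ᵥ Q.mulVec u) := by
    have : κ⁻¹ * (u ⬝ᵥ P.mulVec u) ≤ u ⬝ᵥ Q.mulVec u := by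
      rw [inv_mul_le_iff₀ hκ]; exact h2
    exact mul_le_mul_of_nonneg_left this (inv_nonneg.2 hκ.le)
  have h4 : κ⁻¹ * (u ⬝ᵥ Q.mulVec u) ≤ g ⬝ᵥ P⁻¹.mulVec g := by linarith
  calc g ⬝ᵥ Q⁻¹.mulVec g = u ⬝ᵥ Q.mulVec u := e1
    _ = κ * (κ⁻¹ * (u ⬝ᵥ Q.mulVec u)) := by rw [← mul_assoc, mul_inv_cancel₀ hκ.ne', one_mul]
    _ ≤ κ * (g ⬝ᵥ P⁻¹.mulVec g) := mul_le_mul_of_nonneg_left h4 hκ.le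

/-- **THE INVERSE IS FORM-ANTITONE**: `P ⪯ Q` (symmetric, `P` `σ`-coercive) ⇒ `Q⁻¹ ⪯ P⁻¹`. [folklore] -/
theorem inv_form_antitone (P Q : Matrix ι ι ℝ) (hP : P.IsSymm) {σ : ℝ} (hσ : 0 < σ)
    (hPc : ∀ w, σ * (w ⬝ᵥ w) ≤ w ⬝ᵥ P.mulVec w) (hPQ : ∀ w, w ⬝ᵥ P.mulVec w ≤ w ⬝ᵥ Q.mulVec w) (g : ι → ℝ) :
    g ⬝ᵥ Q⁻¹.mulVec g ≤ g ⬝ᵥ P⁻¹.mulVec g := by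
  have h := inv_form_antitone_smul P Q hP hσ one_pos hPc (fun w => by rw [one_mul]; exact hPQ w) g
  rwa [one_mul] at h

/-- **THE INVERSE FORM OF A COERCIVE MATRIX**: `σ‖w‖² ≤ ⟨w,Pw⟩` for all `w` (`σ > 0`) ⇒ `0 ≤ ⟨g,P⁻¹g⟩ ≤ ‖g‖²∕σ`. [folklore] -/
theorem inv_form_le_of_coercive (P : Matrix ι ι ℝ) {σ : ℝ} (hσ : 0 < σ) (hPc : ∀ w, σ * (w ⬝ᵥ w) ≤ w ⬝ᵥ P.mulVec w)
    (g : ι → ℝ) : 0 ≤ g ⬝ᵥ P⁻¹.mulVec g ∧ g ⬝ᵥ P⁻¹.mulVec g ≤ (g ⬝ᵥ g) / σ := by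
  have hPu : IsUnit P.det := isUnit_det_of_coercive P hσ hPc
  set u := P⁻¹.mulVec g with hu
  have hPu' : P.mulVec u = g := by rw [hu, mulVec_mulVec, mul_nonsing_inv _ hPu, one_mulVec]
  have e1 : g ⬝ᵥ u = u ⬝ᵥ P.mulVec u := by rw [hPu', dotProduct_comm]
  have hc : σ * (u ⬝ᵥ u) ≤ u ⬝ᵥ g := by rw [← hPu']; exact hPc u
  have h := (dot_le_of_coercive_pair hσ u g hc).1
  refine ⟨?_, ?_⟩
  · rw [e1]; exact le_trans (mul_nonneg hσ.le ((Finset.sum_nonneg fun i _ => mul_self_nonneg (u i)))) (hPc u)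
  · rw [dotProduct_comm] at h; exact h

omit [DecidableEq ι] in
/-- **FROM A FORM BOUND TO A NORM BOUND** for a symmetric PSD matrix: `⟨w,Mw⟩ ≤ c‖w‖²` for all `w` (`c ≥ 0`) ⇒ `‖Mg‖² ≤ c²‖g‖²`
(polarised AM–GM `NE7K1LinSchurLineDerivRel.abs_dot_mulVec_le_of_psd` at `λ = c⁻¹`, with `z = Mg`). [folklore] -/
theorem mulVec_sq_le_of_psd (M : Matrix ι ι ℝ) (hM : M.IsSymm) (hpsd : ∀ w, 0 ≤ w ⬝ᵥ M.mulVec w) {c : ℝ} (hc : 0 ≤ c)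
    (hup : ∀ w, w ⬝ᵥ M.mulVec w ≤ c * (w ⬝ᵥ w)) (g : ι → ℝ) :
    M.mulVec g ⬝ᵥ M.mulVec g ≤ c ^ 2 * (g ⬝ᵥ g) := by
  set z := M.mulVec g with hz
  have hzz : 0 ≤ z ⬝ᵥ z := Finset.sum_nonneg fun i _ => mul_self_nonneg (z i)
  have hgg : 0 ≤ g ⬝ᵥ g := Finset.sum_nonneg fun i _ => mul_self_nonneg (g i)
  rcases hc.eq_or_lt with h0 | hcpos
  · -- `c = 0`: the form vanishes, hence so does `M g` (AM–GM at `λ = 1`)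
    have h1 := abs_dot_mulVec_le_of_psd M hM hpsd one_pos z g
    have hz0 : z ⬝ᵥ M.mulVec z ≤ 0 := by have := hup z; rw [← h0, zero_mul] at this; exact this
    have hg0 : g ⬝ᵥ M.mulVec g ≤ 0 := by have := hup g; rw [← h0, zero_mul] at this; exact this
    have h2 : z ⬝ᵥ M.mulVec g ≤ 0 := by
      have := (abs_le.1 h1).2
      rw [one_mul, inv_one, one_mul] at this
      linarith
    rw [← h0]
    have : z ⬝ᵥ z = z ⬝ᵥ M.mulVec g := by rw [hz]
    nlinarith
  · have h1 := abs_dot_mulVec_le_of_psd M hM hpsd (inv_pos.2 hcpos) z g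
    have h2 := (abs_le.1 h1).2
    rw [inv_inv] at h2
    have h3 : c⁻¹ * (z ⬝ᵥ M.mulVec z) ≤ z ⬝ᵥ z := by
      rw [inv_mul_le_iff₀ hcpos]; exact hup z
    have h4 : c * (g ⬝ᵥ M.mulVec g) ≤ c * (c * (g ⬝ᵥ g)) := mul_le_mul_of_nonneg_left (hup g) hcpos.le
    have e : z ⬝ᵥ z = z ⬝ᵥ M.mulVec g := by rw [hz]
    -- `‖z‖² ≤ (‖z‖² + c²‖g‖²)/2`
    nlinarith

end Abstract

end Summit.QuantumFields.BalabanUV.T4Continuum.NE7K1LinInvAntitone
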